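import Mathlib
import HarnessLib
import Literature.Analysis.FluidPDE.SuitableWeak
import Literature.Analysis.FluidPDE.SelfSimilar
import Literature.Analysis.FluidPDE.LocalTypeI
import Literature.Analysis.FluidPDE.SpaceTimeRescaling
import Literature.Analysis.FluidPDE.LocalTypeIScaling
import Literature.Analysis.FluidPDE.LocalTypeIReverseZoom
import Summits.NavierStokesRegularity.NavierStokesRegularity.Theorems.RellichScarApexLocalisationHullClosed
import Summits.NavierStokesRegularity.NavierStokesRegularity.Theorems.RellichScarApexLocalisationMovingCentrePersistence

/-!
# Line `decaying-ancient-bridge` (v3): satellites remember their parent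

Crux `Summit.NavierStokesRegularity.NavierStokesRegularity.Theses.RellichScar.ApexLocalisation`
(stmt-NavierStokesRegularity-11719), skeleton v3 (`Cruxes/ApexLocalisation/Lines/decaying_ancient_bridge.lean`).
Extra structure handed to the bet `stub_sparseSelection` by the landed moving-centre persistence
(`stub_movingCentrePersistence`, p98613): in the second branch of the orbit-closure dichotomy the
limit `v` of shell-centred images `λ_k u(λ_k² t, x_k + λ_k x)` (`λ_k ≤ ‖x_k‖ ≤ 2λ_k`) of an
ORIGIN-SINGULAR continuous class profile `u` is singular not only at the (new) origin but also at
the image of the old origin, a point `(0, e)` with `1 ≤ ‖e‖ ≤ 2` (`parentSingular_of_imageLimit`).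
So every failure of the apex bound inside the class produces a class profile carrying a PARENT–CHILD
PAIR of final-time singular points at unit-comparable distance — the seed of the "genealogy"
bookkeeping (card activity-genealogy-fission) now available sorry-free on the profile side.

Ingredients: the image of the singular origin is a singular point of each image
(`isBackwardSingularPoint_image_preimageOrigin`, `eLpNorm_top_nsZoom`); a singular point of an
everywhere-defined field has, in every backward cylinder around it, points of arbitrarily large
norm (`exists_mem_parabolicCylinder_lt_norm`, no continuity needed); compactness of the shell
`1 ≤ ‖y‖ ≤ 2`; and `stub_movingCentrePersistence` along the extracted subsequence.
-/

-- the summit and its single sub-problem share the name (CONVENTIONS §1), as in every Theorems file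
set_option linter.dupNamespace false

namespace Summit.NavierStokesRegularity.NavierStokesRegularity.Theorems.RellichScarApexLocalisation

open MeasureTheory Set Function Metric Filter Topology TopologicalSpace
open scoped ENNReal NNReal
open Literature.Analysis Literature.Analysis.FluidPDE

local notation "E³" => EuclideanSpace ℝ (Fin 3)

/-! ### Large values near a singular point -/

/-- A backward singular point has, in every backward cylinder around it, a point where the field
exceeds any given bound (otherwise the essential supremum over the cylinder would be finite). -/
theorem exists_mem_parabolicCylinder_lt_norm {w : ℝ → E³ → E³} {z : ℝ × E³}
    (hsing : IsBackwardSingularPoint w z) {r : ℝ} (hr : 0 < r) (M : ℝ) :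
    ∃ q ∈ parabolicCylinder r z, M < ‖w q.1 q.2‖ := by
  by_contra h
  push Not at h
  have hb : ∀ᵐ q ∂(volume.restrict (parabolicCylinder r z)), ‖uncurry w q‖ₑ ≤ ENNReal.ofReal M := by
    have hmeas : MeasurableSet (parabolicCylinder r z) := by
      rw [parabolicCylinder]
      exact measurableSet_Ioo.prod measurableSet_ball
    filter_upwards [ae_restrict_mem hmeas] with q hq
    rw [← ofReal_norm]
    exact ENNReal.ofReal_le_ofReal (h q hq)
  have hfin : eLpNorm (uncurry w) ∞ (volume.restrict (parabolicCylinder r z)) ≤ ENNReal.ofReal M := by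
    rw [eLpNorm_exponent_top]
    exact eLpNormEssSup_le_of_ae_enorm_bound hb
  rw [hsing r hr] at hfin
  exact absurd hfin (not_le.2 ENNReal.ofReal_lt_top)

/-! ### The old origin is a singular point of every image -/

/-- **The image of the singular origin is singular**: if `u` is singular at the space–time origin,
the Navier–Stokes image `c u(c² t, x₀ + c x)` (`c > 0`) is singular at `(0, -c⁻¹ x₀)`, the point
mapped to the origin (`L^∞` norms of the image over `Q((0,-c⁻¹x₀), r)` are `c` times those of `u`
over `Q(0, c r)`, `eLpNorm_top_nsZoom`). -/
theorem isBackwardSingularPoint_image_preimageOrigin {u : ℝ → E³ → E³}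
    (hsing : IsBackwardSingularPoint u 0) {c : ℝ} (hc : 0 < c) (x₀ : E³) :
    IsBackwardSingularPoint (c • stPull (c ^ 2) c 0 x₀ u) ((0 : ℝ), -(c⁻¹ • x₀)) := by
  intro r hr
  rw [eLpNorm_top_nsZoom hc 0 x₀ r ((0 : ℝ), -(c⁻¹ • x₀)) u]
  have h0 : stAffine (c ^ 2) c 0 x₀ ((0 : ℝ), -(c⁻¹ • x₀)) = (0 : ℝ × E³) := by
    rw [stAffine_apply]
    ext1
    · simp
    · show x₀ + c • (-(c⁻¹ • x₀)) = 0
      rw [smul_neg, smul_smul, mul_inv_cancel₀ hc.ne', one_smul, add_neg_cancel]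
  rw [h0, hsing (c * r) (mul_pos hc hr)]
  exact ENNReal.mul_top (ENNReal.ofReal_pos.2 hc).ne'

/-! ### Class data of shell-centred images -/

/-- Class data `(C, I)` and continuity of the Navier–Stokes image `λ u(λ² t, x₀ + λ x)` (`λ > 0`,
centre on the final slice) of a continuous class profile. -/
theorem image_classData {C : ℝ} {I : ℝ≥0∞} {u : ℝ → E³ → E³} {p : ℝ → E³ → ℝ}
    {G : ℝ → E³ → E³ →L[ℝ] E³}
    (hsw : IsSuitableWeakSolutionOn (slab E³ (Iio 0) isOpen_Iio) 1 0 u p)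
    (hwg : HasWeakSpatialGradientOn (slab E³ (Iio 0) isOpen_Iio) u G)
    (hIle : typeIBound (Iio (0 : ℝ) ×ˢ univ) u p G ≤ I)
    (hC : HasTypeITimeDecay C u)
    (hcont : ContinuousOn (uncurry u) (Iio (0 : ℝ) ×ˢ univ)) {lam : ℝ} (hlam : 0 < lam) (x₀ : E³) :
    IsSuitableWeakSolutionOn (slab E³ (Iio 0) isOpen_Iio) 1 0 (lam • stPull (lam ^ 2) lam 0 x₀ u)
        (lam ^ 2 • stPull (lam ^ 2) lam 0 x₀ p) ∧
      HasWeakSpatialGradientOn (slab E³ (Iio 0) isOpen_Iio) (lam • stPull (lam ^ 2) lam 0 x₀ u)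
        (lam ^ 2 • stPull (lam ^ 2) lam 0 x₀ G) ∧
      typeIBound (Iio (0 : ℝ) ×ˢ univ) (lam • stPull (lam ^ 2) lam 0 x₀ u)
        (lam ^ 2 • stPull (lam ^ 2) lam 0 x₀ p) (lam ^ 2 • stPull (lam ^ 2) lam 0 x₀ G) ≤ I ∧
      HasTypeITimeDecay C (lam • stPull (lam ^ 2) lam 0 x₀ u) ∧
      ContinuousOn (uncurry (lam • stPull (lam ^ 2) lam 0 x₀ u)) (Iio (0 : ℝ) ×ˢ univ) := by
  have hpre := slab_le_stPreimage_hullImage le_rfl hlam x₀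
  refine ⟨(zoom_isSuitableWeakSolutionOn hsw hlam 0 x₀).of_le hpre,
    (zoom_hasWeakSpatialGradientOn hwg hlam 0 x₀).mono hpre, ?_,
    hasTypeITimeDecay_hullImage hC le_rfl hlam, continuousOn_hullImage hcont le_rfl hlam⟩
  exact typeIBound_le_iff.2 fun r hr z hz =>
    (abScaledSum_zoom_le_typeIBound hlam le_rfl x₀ hr
      (fst_nonpos_of_parabolicCylinder_subset_lowerHalf hr hz)).trans hIle

/-! ### Satellites remember their parent -/

/-- **Parent–child pair.** Let `(u,p,G)` be a continuous rate-Type-I suitable weak slab profile with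
`𝐈 ≤ I < ⊤`, SINGULAR AT THE ORIGIN, and let shell-centred images
`w_k(t,x) = λ_k u(λ_k² t, x_k + λ_k x)` (`0 < λ_k ≤ ‖x_k‖ ≤ 2λ_k`) converge in `L³(Q(0,R))` for every
`R > 0` to a field `v` which is (the velocity of) a suitable weak slab solution. Then `v` is singular
at some point `(0, e)` of the closed shell `1 ≤ ‖e‖ ≤ 2` — the limit position of the old origin
`-x_k/λ_k`. (Each `w_k` is singular at `-x_k/λ_k`, so it has points `(t_k, x_k')` with
`-1/(k+1)² < t_k < 0`, `‖x_k' + x_k/λ_k‖ < 1/(k+1)`, `‖w_k(t_k,x_k')‖ > k`; along a subsequence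
`-x_k/λ_k → e`, and `stub_movingCentrePersistence` applies.) -/
theorem parentSingular_of_imageLimit {C : ℝ} {I : ℝ≥0∞} {u : ℝ → E³ → E³} {p : ℝ → E³ → ℝ}
    {G : ℝ → E³ → E³ →L[ℝ] E³} (hI : I < ⊤)
    (hsw : IsSuitableWeakSolutionOn (slab E³ (Iio 0) isOpen_Iio) 1 0 u p)
    (hwg : HasWeakSpatialGradientOn (slab E³ (Iio 0) isOpen_Iio) u G)
    (hIle : typeIBound (Iio (0 : ℝ) ×ˢ univ) u p G ≤ I)
    (hC : HasTypeITimeDecay C u)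
    (hcont : ContinuousOn (uncurry u) (Iio (0 : ℝ) ×ˢ univ))
    (hsing : IsBackwardSingularPoint u 0)
    {lk : ℕ → ℝ} {xk : ℕ → E³} (hadm : ∀ k, 0 < lk k ∧ lk k ≤ ‖xk k‖ ∧ ‖xk k‖ ≤ 2 * lk k)
    {v : ℝ → E³ → E³} {q : ℝ → E³ → ℝ}
    (hv : IsSuitableWeakSolutionOn (slab E³ (Iio 0) isOpen_Iio) 1 0 v q)
    (hconv : ∀ R : ℝ, 0 < R → Tendsto (fun k => eLpNorm
      (uncurry (lk k • stPull (lk k ^ 2) (lk k) 0 (xk k) u) - uncurry v) 3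
      (volume.restrict (parabolicCylinder R (0 : ℝ × E³)))) atTop (𝓝 0)) :
    ∃ e : E³, 1 ≤ ‖e‖ ∧ ‖e‖ ≤ 2 ∧ IsBackwardSingularPoint v ((0 : ℝ), e) := by
  -- the old origin in image coordinates
  set y : ℕ → E³ := fun k => -((lk k)⁻¹ • xk k) with hy
  have hynorm : ∀ k, ‖y k‖ = ‖xk k‖ / lk k := fun k => by
    rw [hy]
    simp only [norm_neg, norm_smul, norm_inv, Real.norm_of_nonneg (hadm k).1.le]
    rw [div_eq_inv_mul]
  have hy1 : ∀ k, 1 ≤ ‖y k‖ := fun k => by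
    rw [hynorm, le_div_iff₀ (hadm k).1, one_mul]
    exact (hadm k).2.1
  have hy2 : ∀ k, ‖y k‖ ≤ 2 := fun k => by
    rw [hynorm, div_le_iff₀ (hadm k).1]
    exact (hadm k).2.2
  -- each image is singular at `y k`: pick points of large norm nearby
  have hWsing : ∀ k, IsBackwardSingularPoint (lk k • stPull (lk k ^ 2) (lk k) 0 (xk k) u) ((0 : ℝ), y k) :=
    fun k => isBackwardSingularPoint_image_preimageOrigin hsing (hadm k).1 (xk k)
  have hpts : ∀ k : ℕ, ∃ qq ∈ parabolicCylinder (1 / ((k : ℝ) + 1)) ((0 : ℝ), y k),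
      (k : ℝ) < ‖(lk k • stPull (lk k ^ 2) (lk k) 0 (xk k) u) qq.1 qq.2‖ := fun k =>
    exists_mem_parabolicCylinder_lt_norm (hWsing k) (by positivity) k
  choose qq hqq hqval using hpts
  -- a convergent subsequence of the old origins
  obtain ⟨e, he, φ, hφ, hye⟩ : ∃ e ∈ closedBall (0 : E³) 2, ∃ φ : ℕ → ℕ, StrictMono φ ∧
      Tendsto (y ∘ φ) atTop (𝓝 e) :=
    (isCompact_closedBall (0 : E³) 2).tendsto_subseq fun k => by
      rw [mem_closedBall, dist_zero_right]; exact hy2 k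
  have he2 : ‖e‖ ≤ 2 := by simpa [mem_closedBall] using he
  have he1 : 1 ≤ ‖e‖ :=
    ge_of_tendsto (hye.norm) (Eventually.of_forall fun k => hy1 (φ k))
  refine ⟨e, he1, he2, ?_⟩
  -- the data of the images along `φ`
  have hcd := fun k => image_classData hsw hwg hIle hC hcont (hadm k).1 (xk k)
  have hli : LocallyIntegrableOn (uncurry v) (Iio (0 : ℝ) ×ˢ (univ : Set E³)) volume := by
    have := hv.distributional.1
    rwa [coe_slab] at this
  -- times, centres and values of the chosen points along `φ`
  have ht_lt : ∀ k : ℕ, (qq k).1 < 0 := fun k => by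
    have := hqq k
    rw [mem_parabolicCylinder] at this
    simpa using this.1.2
  have ht_gt : ∀ k : ℕ, -(1 / ((k : ℝ) + 1)) ^ 2 < (qq k).1 := fun k => by
    have := hqq k
    rw [mem_parabolicCylinder] at this
    simpa using this.1.1
  have hx_near : ∀ k : ℕ, dist (qq k).2 (y k) < 1 / ((k : ℝ) + 1) := fun k => by
    have := hqq k
    rw [mem_parabolicCylinder] at this
    exact this.2
  have hk1 : Tendsto (fun k : ℕ => 1 / ((k : ℝ) + 1)) atTop (𝓝 0) := tendsto_one_div_add_atTop_nhds_zero_nat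
  have htk0 : Tendsto (fun k => (qq (φ k)).1) atTop (𝓝 0) := by
    have hlow : Tendsto (fun k : ℕ => -(1 / ((φ k : ℝ) + 1)) ^ 2) atTop (𝓝 0) := by
      have h1 : Tendsto (fun k : ℕ => 1 / (((φ k : ℕ) : ℝ) + 1)) atTop (𝓝 0) :=
        hk1.comp hφ.tendsto_atTop
      have : Tendsto (fun k : ℕ => -((1 / (((φ k : ℕ) : ℝ) + 1)) ^ 2)) atTop (𝓝 (-(0 ^ 2))) :=
        (h1.pow 2).neg
      simpa [neg_pow_two] using this
    exact tendsto_of_tendsto_of_tendsto_of_le_of_le hlow tendsto_const_nhds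
      (fun k => (ht_gt (φ k)).le) (fun k => (ht_lt (φ k)).le)
  have hxk : Tendsto (fun k => (qq (φ k)).2) atTop (𝓝 e) := by
    refine (tendsto_iff_dist_tendsto_zero).2 ?_
    have hd : ∀ k, dist (qq (φ k)).2 e ≤ 1 / (((φ k : ℕ) : ℝ) + 1) + dist (y (φ k)) e := fun k =>
      (dist_triangle _ (y (φ k)) _).trans (add_le_add (hx_near (φ k)).le le_rfl)
    have h0 : Tendsto (fun k => 1 / (((φ k : ℕ) : ℝ) + 1) + dist (y (φ k)) e) atTop (𝓝 0) := by
      have h1 : Tendsto (fun k : ℕ => 1 / (((φ k : ℕ) : ℝ) + 1)) atTop (𝓝 0) :=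
        hk1.comp hφ.tendsto_atTop
      have h2 : Tendsto (fun k => dist (y (φ k)) e) atTop (𝓝 0) :=
        (tendsto_iff_dist_tendsto_zero).1 hye
      simpa using h1.add h2
    exact squeeze_zero (fun k => dist_nonneg) hd h0
  have hblow : Tendsto (fun k => ‖(lk (φ k) • stPull (lk (φ k) ^ 2) (lk (φ k)) 0 (xk (φ k)) u)
      (qq (φ k)).1 (qq (φ k)).2‖) atTop atTop := by
    refine tendsto_atTop_mono (fun k => (hqval (φ k)).le) ?_
    exact tendsto_natCast_atTop_atTop.comp hφ.tendsto_atTop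
  -- moving-centre persistence along `φ`
  exact stub_movingCentrePersistence I
    (fun k => lk (φ k) • stPull (lk (φ k) ^ 2) (lk (φ k)) 0 (xk (φ k)) u)
    (fun k => lk (φ k) ^ 2 • stPull (lk (φ k) ^ 2) (lk (φ k)) 0 (xk (φ k)) p)
    (fun k => lk (φ k) ^ 2 • stPull (lk (φ k) ^ 2) (lk (φ k)) 0 (xk (φ k)) G)
    v (fun k => (qq (φ k)).1) (fun k => (qq (φ k)).2) e hI
    (fun k => (hcd (φ k)).1) (fun k => (hcd (φ k)).2.1) (fun k => (hcd (φ k)).2.2.1)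
    (fun k => (hcd (φ k)).2.2.2.2) hli
    (fun R hR => (hconv R hR).comp hφ.tendsto_atTop)
    (fun k => ht_lt (φ k)) htk0 hxk hblow

end Summit.NavierStokesRegularity.NavierStokesRegularity.Theorems.RellichScarApexLocalisation
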